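import Mathlib
import HarnessLib
import Summits.Langlands.Langlands.Theses.K3SpinSixteen
import Literature.NumberTheory.GaloisRepresentations.ResidualPairIntegrality

/-!
# K3SpinSixteen — proof of the layer-1 glue `GlueToTarget` (stmt-Langlands-12829)

`GlueToTarget : OrthogonalK3Lifting → OrdinaryFamilyAnchor → K3SixteenAutomorphy`
(route-Langlands-K3SpinSixteen, binder `hG` of its deciding theorem `closes`).

Proof (elementary, as announced in the item's docstring).  Fix the data of
`K3SixteenAutomorphy`: the imaginary quadratic `E`, `τ ∉ res Γ_E`, a level structure `hcpt`, a
prime `ℓ`, `ι : ℚ̄_ℓ ≅ ℂ`, a member `ρ : Γ_ℚ → GL_6(ℚ̄_ℓ)` of the `ℚ`-rational family `(bad, P)`,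
an infinite set `S` of primes and good companions `rf p` (`p ∈ S`) of the same family.
1. `OrdinaryFamilyAnchor` gives `p ∈ S`, `p ≠ 2` split in `E`, a congruent mate `r'` of `rf p`
   of the same type, `ι₀ : ℚ̄_p ≅ ℂ` and (for our `hcpt`) an `L`-algebraic cuspidal `π'`
   Satake-matching `r'` a.e. through `ι₀`.
2. `OrthogonalK3Lifting` (fed with the companion clauses of `rf p` and the data of `r'`) gives an
   `L`-algebraic cuspidal `π` of `GL_6(𝔸_ℚ)` Satake-matching `rf p` a.e. through `ι₀`.
3. Transport `(rf p, ι₀) ↦ (ρ, ι)`: off the finite set `bad ∪ {v ∣ p} ∪ {v ∣ ℓ}` both `rf p` and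
   `ρ` are unramified with Frobenius characteristic polynomial the RATIONAL `P v` (read in `ℚ̄_p`,
   `ℚ̄_ℓ`).  Ring maps out of `ℚ` are unique, so both are the images under `ι₀⁻¹`, `ι⁻¹` of the
   complex polynomial `(P v) ⊗ ℂ` (`arithFrobPolyOfSatake_one_eq_map_symm`); uniqueness of
   Frobenius characteristic polynomials
   (`FramedGaloisRep.HasFrobCharpolyAt.unique`) identifies the `ι₀`-Satake polynomial of `π_v`
   with `P v`, and injectivity of `Polynomial.map ι₀⁻¹` then gives the `ι`-Satake polynomial
   `= P v` over `ℚ̄_ℓ` (`arithFrobPolyOfSatake_ratSwitch`), i.e. `SatakeFrobCompatibleAt ι π ρ v`.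
   Finitely many places divide `p` or `ℓ` (`Ideal.finite_factors`), so this holds
   `∀ᶠ v in cofinite`.

Route-independent imports only (no other `Theses` file in the cone).  No definition, no named
unproved fact as a hypothesis, no `sorry`.
References: Buzzard–Gee, *The conjectural connections between automorphic representations and
Galois representations* (2014), Conj. 3.2.1 [BuzzardGeeLMS2014]; Serre, *Abelian ℓ-adic
representations* (1968), Ch. I §2.1, §2.3 (Frobenius polynomials of a rational compatible
system) [SerreAbelianLadic1968].
-/

set_option linter.dupNamespace false

namespace Summit.Langlands.Langlands.Theorems.K3SpinSixteenGlueToTarget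

open Filter Polynomial IsDedekindDomain NumberField
open Literature.NumberTheory.GaloisRepresentations
open Literature.NumberTheory.Automorphic
open Summit.Langlands.Langlands.Theses
open Summit.Langlands.Langlands.Theses.K3SpinSixteen

/-- Ring homomorphisms out of `ℚ` are unique: the `ι⁻¹`-image of the complexification of a
rational polynomial `Q` is the `ℚ̄_ℓ`-image of `Q`. [folklore] -/
theorem map_map_symm_ratCast {ℓ : ℕ} [Fact ℓ.Prime] (ι : PadicAlgCl ℓ ≃+* ℂ) (Q : Polynomial ℚ) :
    (Q.map (algebraMap ℚ ℂ)).map (ι.symm : ℂ →+* PadicAlgCl ℓ) =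
      Q.map (algebraMap ℚ (PadicAlgCl ℓ)) := by
  rw [Polynomial.map_map]
  congr 1
  exact Subsingleton.elim _ _

/-- At the `L`-normalisation `m = 1`, `arithFrobPolyOfSatake ι q 1 α` is `ι⁻¹` applied
coefficientwise to the COMPLEX polynomial `∏_{a ∈ α} (X - a⁻¹)` (`arithFrobPolyOfSatake_one`,
`Polynomial.map_multiset_prod`).  Buzzard–Gee 2014, §2.1. [folklore] -/
theorem arithFrobPolyOfSatake_one_eq_map_symm {ℓ : ℕ} [Fact ℓ.Prime] (ι : PadicAlgCl ℓ ≃+* ℂ)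
    (q : ℕ) (α : Multiset ℂ) :
    arithFrobPolyOfSatake ι q 1 α =
      ((α.map fun a ↦ X - C a⁻¹).prod).map (ι.symm : ℂ →+* PadicAlgCl ℓ) := by
  rw [arithFrobPolyOfSatake_one, Polynomial.map_multiset_prod, Multiset.map_map]
  congr 1
  refine Multiset.map_congr rfl fun a _ ↦ ?_
  simp

/-- **Prime switch for rational Satake polynomials.**  If the `ι₀`-predicted Frobenius polynomial
(`L`-normalisation) of the Satake datum `(q, α)` is the `ℚ̄_p`-image of a rational polynomial `Q`,
then the `ι`-predicted one is the `ℚ̄_ℓ`-image of `Q`: both are images of one complex polynomial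
(`arithFrobPolyOfSatake_one_eq_map_symm`), `Polynomial.map ι₀⁻¹` is injective, and ring maps out
of `ℚ` are unique.  Serre 1968, Ch. I §2.3 (rationality of a compatible system is independent of
the prime). [folklore] -/
theorem arithFrobPolyOfSatake_ratSwitch {ℓ p : ℕ} [Fact ℓ.Prime] [Fact p.Prime]
    (ι : PadicAlgCl ℓ ≃+* ℂ) (ι₀ : PadicAlgCl p ≃+* ℂ) (q : ℕ) (α : Multiset ℂ)
    (Q : Polynomial ℚ) (h : arithFrobPolyOfSatake ι₀ q 1 α = Q.map (algebraMap ℚ (PadicAlgCl p))) :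
    arithFrobPolyOfSatake ι q 1 α = Q.map (algebraMap ℚ (PadicAlgCl ℓ)) := by
  rw [arithFrobPolyOfSatake_one_eq_map_symm, ← map_map_symm_ratCast ι₀] at h
  have hinj : Function.Injective (ι₀.symm : ℂ →+* PadicAlgCl p) := ι₀.symm.injective
  rw [arithFrobPolyOfSatake_one_eq_map_symm, ← map_map_symm_ratCast ι,
    Polynomial.map_injective _ hinj h]

/-- **Transport of Satake–Frobenius compatibility at one place along a rational family.**  If
`ρ` (over `ℚ̄_ℓ`) is unramified at `v` with Frobenius polynomial `Q ∈ ℚ[X]`, `r` (over `ℚ̄_p`)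
has Frobenius polynomial `Q` at `v`, and `π` is Satake–Frobenius compatible with `r` at `v`
through `ι₀`, then `π` is Satake–Frobenius compatible with `ρ` at `v` through `ι`
(`HasFrobCharpolyAt.unique` + `arithFrobPolyOfSatake_ratSwitch`).  Buzzard–Gee 2014,
Conj. 3.2.1. [folklore] -/
theorem satakeFrobCompatibleAt_ratSwitch {K : Type} [Field K] [NumberField K] {n : ℕ}
    {hcpt : isCompact_glFiniteIntegralLevel n K} {ℓ p : ℕ} [Fact ℓ.Prime] [Fact p.Prime]
    (ι : PadicAlgCl ℓ ≃+* ℂ) (ι₀ : PadicAlgCl p ≃+* ℂ) (π : CuspidalAutomorphicRepData n K hcpt)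
    (ρ : FramedGaloisRep K (PadicAlgCl ℓ) n) (r : FramedGaloisRep K (PadicAlgCl p) n)
    (v : HeightOneSpectrum (𝓞 K)) (Q : Polynomial ℚ) (hρu : ρ.IsUnramifiedAt v)
    (hρQ : ρ.HasFrobCharpolyAt v (Q.map (algebraMap ℚ (PadicAlgCl ℓ))))
    (hrQ : r.HasFrobCharpolyAt v (Q.map (algebraMap ℚ (PadicAlgCl p))))
    (h : SatakeFrobCompatibleAt ι₀ π.1 r v) : SatakeFrobCompatibleAt ι π.1 ρ v := by
  obtain ⟨α, hα, -, hfrob⟩ := h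
  refine ⟨α, hα, hρu, ?_⟩
  rw [arithFrobPolyOfSatake_ratSwitch ι ι₀ v.residueCard α Q (hfrob.unique hrQ)]
  exact hρQ

/-- **Transport of a.e. Satake–Frobenius compatibility along a `ℚ`-rational family.**  If
`ρ : Γ_K → GL_n(ℚ̄_ℓ)` and `r : Γ_K → GL_n(ℚ̄_p)` are, off a finite set `bad` and away from their
own residue characteristics, unramified with the same RATIONAL Frobenius characteristic
polynomials `P v`, then a cuspidal `π` Satake-matching `r` a.e. through `ι₀ : ℚ̄_p ≅ ℂ`
Satake-matches `ρ` a.e. through any `ι : ℚ̄_ℓ ≅ ℂ`; the exceptional set is contained in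
`bad ∪ {v ∣ ℓ} ∪ {v ∣ p} ∪` (exceptions of `π` vs `r`), finite by `Ideal.finite_factors`.
Serre, *Abelian ℓ-adic representations* (1968), Ch. I §2.3; Buzzard–Gee 2014, Conj. 3.2.1.
[folklore] -/
theorem eventually_satakeFrobCompatibleAt_of_ratFamily {K : Type} [Field K] [NumberField K]
    {n : ℕ} {hcpt : isCompact_glFiniteIntegralLevel n K} {ℓ p : ℕ} [Fact ℓ.Prime] [Fact p.Prime]
    (ι : PadicAlgCl ℓ ≃+* ℂ) (ι₀ : PadicAlgCl p ≃+* ℂ) (π : CuspidalAutomorphicRepData n K hcpt)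
    (ρ : FramedGaloisRep K (PadicAlgCl ℓ) n) (r : FramedGaloisRep K (PadicAlgCl p) n)
    (bad : Finset (HeightOneSpectrum (𝓞 K))) (P : HeightOneSpectrum (𝓞 K) → Polynomial ℚ)
    (hρ : ∀ v ∉ bad, ((ℓ : ℕ) : 𝓞 K) ∉ v.asIdeal →
      ρ.IsUnramifiedAt v ∧ ρ.HasFrobCharpolyAt v ((P v).map (algebraMap ℚ (PadicAlgCl ℓ))))
    (hr : ∀ v ∉ bad, ((p : ℕ) : 𝓞 K) ∉ v.asIdeal →
      r.IsUnramifiedAt v ∧ r.HasFrobCharpolyAt v ((P v).map (algebraMap ℚ (PadicAlgCl p))))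
    (hπ : ∀ᶠ v in cofinite, SatakeFrobCompatibleAt ι₀ π.1 r v) :
    ∀ᶠ v in cofinite, SatakeFrobCompatibleAt ι π.1 ρ v := by
  -- only finitely many places of `K` lie above a non-zero rational integer
  have away : ∀ m : ℕ, m ≠ 0 → ∀ᶠ v : HeightOneSpectrum (𝓞 K) in cofinite,
      ((m : ℕ) : 𝓞 K) ∉ v.asIdeal := fun m hm => by
    have h0 : (Ideal.span {((m : ℕ) : 𝓞 K)} : Ideal (𝓞 K)) ≠ ⊥ := by
      rw [Ne, Ideal.span_singleton_eq_bot]; exact_mod_cast hm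
    refine Set.Finite.eventually_cofinite_notMem ((Ideal.finite_factors h0).subset fun v hv => ?_)
    change v.asIdeal ∣ Ideal.span {((m : ℕ) : 𝓞 K)}
    rw [Ideal.dvd_span_singleton]
    exact hv
  have hbad : ∀ᶠ v : HeightOneSpectrum (𝓞 K) in cofinite, v ∉ bad :=
    (bad.finite_toSet.eventually_cofinite_notMem).mono fun v hv => by simpa using hv
  filter_upwards [hbad, away ℓ (Fact.out : ℓ.Prime).ne_zero, away p (Fact.out : p.Prime).ne_zero, hπ]
    with v hvb hvℓ hvp hv
  obtain ⟨hρu, hρP⟩ := hρ v hvb hvℓ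
  obtain ⟨-, hrP⟩ := hr v hvb hvp
  exact satakeFrobCompatibleAt_ratSwitch ι ι₀ π ρ r v (P v) hρu hρP hrP hv

/-- **`GlueToTarget` holds** (stmt-Langlands-12829, proved outright): the anchor crux supplies a
split prime `p ∈ S`, a congruent automorphic mate `r'` and `ι₀`; the lifting crux then makes `rf p`
Satake-match an `L`-algebraic cuspidal `π` through `ι₀`; the rational family `(bad, P)` transports
this to `(ρ, ι)` (`eventually_satakeFrobCompatibleAt_of_ratFamily`). [folklore] -/
theorem glueToTarget_proof : Summit.Langlands.Langlands.Theses.K3SpinSixteen.GlueToTarget := by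
  intro hL hA E _ _ _ _ hE τ hτ hcpt ℓ _ ι ρ bad P hρ S hS hSp rf hrf
  obtain ⟨p, hpF, hpS, hp2, hsplit, r', hJ', hdet', hord', hur', hcong, ι₀, hπ'⟩ :=
    hA E hE τ hτ bad P S hS hSp rf hrf
  obtain ⟨hfam, hJ, hdet, hord, hur, hirr⟩ := hrf p hpS
  obtain ⟨π', hπ'alg, hπ'c⟩ := hπ' hcpt
  obtain ⟨π, hπalg, hπc⟩ := hL E hE τ hτ p hp2 hsplit ι₀ hcpt (rf p) r' hJ hdet hord hur hirr
    hJ' hdet' hord' hur' hcong ⟨π', hπ'alg, hπ'c⟩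
  exact ⟨π, hπalg, eventually_satakeFrobCompatibleAt_of_ratFamily ι ι₀ π ρ (rf p) bad P hρ hfam hπc⟩

end Summit.Langlands.Langlands.Theorems.K3SpinSixteenGlueToTarget
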